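import Mathlib.RingTheory.Finiteness.Cardinality
import Mathlib.Algebra.Module.Projective
import Literature.Algebra.Module.IdempotentMatrixFixedTensor
import HarnessLib

/-!
# Idempotent presentations of finite projective modules: modules ↦ idempotent matrices, linear maps ↦ intertwiners

Topic `Algebra/Module`, namespace `Literature.Algebra.Module.IdempotentMatrix` (pure commutative algebra over a commutative ring `R`;
constructions with bodies + proved theorems; no named fact, no `sorry`, no `instance`, no notation).  Cell `hodgecm-mathlib`, F0/P6 «MOD»,
P6a organ (g2) MODULE-SIDE DICTIONARY for Serre's tensor construction (the scheme side, ★ `AlgebraicGeometry/AbelianSchemes/SerreTensor*`,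
works with presentations `E² = E ∈ Mₙ(𝒪)` and intertwiners `E′P = PE`; this file says how actual finite projective modules and their maps
produce such data); `--supports stmt-HodgeConjecture-24832`, count-neutral.  HC_CM is proved only modulo the 2 remaining named inputs
(hLiu418, h413) until rung 0 closes; this file discharges none of them.

## Mathematics

A finitely generated projective `R`-module `M` is a direct summand of some `Rⁿ`: choose a surjection `p : Rⁿ ↠ M` and a section `s`
(`p ∘ s = id`, projectivity).  Then `E := [s ∘ p] ∈ Mₙ(R)` is idempotent and `s : M ≅ E·Rⁿ = range E`.  Given two such presentations
`M ≅ E·Rⁿ`, `M′ ≅ E′·Rᵐ`, an `R`-linear map `φ : E·Rⁿ → E′·Rᵐ` has the matrix `P(φ) := [ι′ ∘ φ ∘ π] ∈ M_{m×n}(R)` (`π : Rⁿ → E·Rⁿ` the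
projection `f ↦ Ef`, `ι′` the inclusion), which satisfies `E′ P = P = P E` — so in particular the one-sided intertwining `E′P = PE` used on
the scheme side — is functorial (`P(id) = E`, `P(ψ ∘ φ) = P(ψ) P(φ)`), additive, recovers `φ` (`P(φ)·x = φ(x)` for `x ∈ E·Rⁿ`), and turns an
isomorphism `φ` into an intertwining PAIR `(P(φ), P(φ⁻¹))` with `P(φ⁻¹) P(φ) = E`, `P(φ) P(φ⁻¹) = E′` (the hypothesis of presentation
independence).  This is the idempotent-completion (Karoubi) description of finite projective modules (B. Conrad, *Gross–Zagier revisited*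
§7 uses a finite presentation of `M` to define `M ⊗_𝒪 A`; for projective `M` the presentation may be taken split, i.e. idempotent).

## Contents

* §1 split pairs: `toMatrix'_comp_idem` (`[s∘p]² = [s∘p]`), `range_toLin'_toMatrix'_comp`, `splitRangeEquiv p s h : M ≃ₗ range (toLin' [s∘p])`,
  **`exists_idempotent_presentation`** (`Module.Finite` + `Module.Projective` ⇒ `∃ n E, E*E = E ∧ Nonempty (M ≃ₗ range (toLin' E))`);
* §2 `toLin'_comp_subtype` (`E ∘ ι = ι`), `rangeProj_comp_toLin'` (`π ∘ E = π`), **`presMatrix E E' φ`** with `mul_presMatrix` (`E′P = P`),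
  `presMatrix_mul` (`PE = P`), `presMatrix_intertwines` (`E′P = PE`), `presMatrix_id`, `presMatrix_comp`, `presMatrix_add`, `presMatrix_zero`,
  `presMatrix_smul`, `toLin'_presMatrix_subtype` (`P·x = φ x`), `presMatrix_symm_mul`∕`presMatrix_mul_symm` (iso ↦ intertwining pair).

## References
* [Conrad2004GrossZagier] B. Conrad, *Gross–Zagier revisited*, MSRI Publ. 49 (2004), §7.
* [Bourbaki1989CommAlg] N. Bourbaki, *Commutative Algebra*, Ch. II §5.2 (finitely generated projective modules as direct summands of free ones).
* Tree: ★ `Algebra/Module/IdempotentMatrixFixedTensor` (`rangeProj`, `rangeProj_comp_subtype`, `subtype_comp_rangeProj`).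
-/

namespace Literature.Algebra.Module.IdempotentMatrix

open Matrix

variable {R : Type*} [CommRing R] {M : Type*} [AddCommGroup M] [Module R M]

/-! ## §1 Split surjections from `Rⁿ` and the existence of an idempotent presentation -/

section Split

variable {n : ℕ} (p : (Fin n → R) →ₗ[R] M) (s : M →ₗ[R] (Fin n → R))

/-- For a split pair `p ∘ s = id`, the matrix `E = [s ∘ p]` is idempotent. [cite: Conrad2004GrossZagier, §7] -/
theorem toMatrix'_comp_idem (h : p ∘ₗ s = LinearMap.id) :
    LinearMap.toMatrix' (s ∘ₗ p) * LinearMap.toMatrix' (s ∘ₗ p) = LinearMap.toMatrix' (s ∘ₗ p) := by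
  rw [← LinearMap.toMatrix'_comp, LinearMap.comp_assoc, ← LinearMap.comp_assoc p s p, h, LinearMap.id_comp]

/-- For a split pair, `range (toLin' [s ∘ p]) = range s`. [cite: Conrad2004GrossZagier, §7] -/
theorem range_toLin'_toMatrix'_comp (h : p ∘ₗ s = LinearMap.id) :
    LinearMap.range (Matrix.toLin' (LinearMap.toMatrix' (s ∘ₗ p))) = LinearMap.range s := by
  rw [Matrix.toLin'_toMatrix']
  have hp : Function.Surjective p := fun x => ⟨s x, by rw [← LinearMap.comp_apply, h, LinearMap.id_apply]⟩
  exact LinearMap.range_comp_of_range_eq_top s (LinearMap.range_eq_top.mpr hp)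

/-- For a split pair, `s` is an isomorphism `M ≅ E·Rⁿ = range (toLin' E)`, `E = [s ∘ p]`. [cite: Conrad2004GrossZagier, §7] -/
noncomputable def splitRangeEquiv (h : p ∘ₗ s = LinearMap.id) :
    M ≃ₗ[R] LinearMap.range (Matrix.toLin' (LinearMap.toMatrix' (s ∘ₗ p))) :=
  (LinearEquiv.ofInjective s (fun x y hxy => by
      rw [← LinearMap.id_apply (R := R) x, ← LinearMap.id_apply (R := R) y, ← h, LinearMap.comp_apply, LinearMap.comp_apply, hxy])).trans
    (LinearEquiv.ofEq _ _ (range_toLin'_toMatrix'_comp p s h).symm)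

/-- `splitRangeEquiv x = s x` as vectors. [cite: Conrad2004GrossZagier, §7] -/
theorem splitRangeEquiv_apply_coe (h : p ∘ₗ s = LinearMap.id) (x : M) : (splitRangeEquiv p s h x : Fin n → R) = s x := rfl

/-- **Every finite projective module has an idempotent presentation** `M ≅ E·Rⁿ`, `E² = E`.
[cite: Conrad2004GrossZagier, §7] -/
theorem exists_idempotent_presentation (R : Type*) [CommRing R] (M : Type*) [AddCommGroup M] [Module R M] [Module.Finite R M]
    [Module.Projective R M] :
    ∃ (n : ℕ) (E : Matrix (Fin n) (Fin n) R), E * E = E ∧ Nonempty (M ≃ₗ[R] LinearMap.range (Matrix.toLin' E)) := by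
  obtain ⟨n, p, hp⟩ := Module.Finite.exists_fin' R M
  obtain ⟨s, hs⟩ := Module.projective_lifting_property p LinearMap.id hp
  exact ⟨n, _, toMatrix'_comp_idem p s hs, ⟨splitRangeEquiv p s hs⟩⟩

end Split

/-! ## §2 Linear maps between presented modules ↦ intertwining matrices -/

section PresMatrix

variable {m n k : ℕ} (E : Matrix (Fin n) (Fin n) R) (E' : Matrix (Fin m) (Fin m) R) (E'' : Matrix (Fin k) (Fin k) R)

variable {E} in
/-- `E ∘ ι = ι` on `range E` (idempotent `E`). [cite: Conrad2004GrossZagier, §7] -/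
theorem toLin'_comp_subtype (hE : E * E = E) :
    Matrix.toLin' E ∘ₗ (LinearMap.range (Matrix.toLin' E)).subtype = (LinearMap.range (Matrix.toLin' E)).subtype := by
  refine LinearMap.ext fun x => ?_
  obtain ⟨f, g, rfl⟩ := x
  change Matrix.toLin' E (Matrix.toLin' E g) = Matrix.toLin' E g
  rw [← LinearMap.comp_apply, ← Matrix.toLin'_mul, hE]

variable {E} in
/-- `π ∘ E = π` (idempotent `E`). [cite: Conrad2004GrossZagier, §7] -/
theorem rangeProj_comp_toLin' (hE : E * E = E) : rangeProj E ∘ₗ Matrix.toLin' E = rangeProj E := by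
  refine LinearMap.ext fun g => Subtype.ext ?_
  change Matrix.toLin' E (Matrix.toLin' E g) = Matrix.toLin' E g
  rw [← LinearMap.comp_apply, ← Matrix.toLin'_mul, hE]

/-- **The matrix of a linear map of presented modules**: `P(φ) := [ι′ ∘ φ ∘ π] ∈ M_{m×n}(R)`. [cite: Conrad2004GrossZagier, §7] -/
noncomputable def presMatrix (φ : LinearMap.range (Matrix.toLin' E) →ₗ[R] LinearMap.range (Matrix.toLin' E')) : Matrix (Fin m) (Fin n) R :=
  LinearMap.toMatrix' ((LinearMap.range (Matrix.toLin' E')).subtype ∘ₗ φ ∘ₗ rangeProj E)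

variable (φ : LinearMap.range (Matrix.toLin' E) →ₗ[R] LinearMap.range (Matrix.toLin' E'))

/-- `toLin' P(φ) = ι′ ∘ φ ∘ π`. [cite: Conrad2004GrossZagier, §7] -/
theorem toLin'_presMatrix :
    Matrix.toLin' (presMatrix E E' φ) = (LinearMap.range (Matrix.toLin' E')).subtype ∘ₗ φ ∘ₗ rangeProj E :=
  Matrix.toLin'_toMatrix' _

variable {E'} in
/-- `E′ P(φ) = P(φ)` (idempotent `E′`). [cite: Conrad2004GrossZagier, §7] -/
theorem mul_presMatrix (hE' : E' * E' = E') : E' * presMatrix E E' φ = presMatrix E E' φ := by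
  have h : Matrix.toLin' E' ∘ₗ ((LinearMap.range (Matrix.toLin' E')).subtype ∘ₗ φ ∘ₗ rangeProj E) =
      (LinearMap.range (Matrix.toLin' E')).subtype ∘ₗ φ ∘ₗ rangeProj E := by
    rw [← LinearMap.comp_assoc, toLin'_comp_subtype hE']
  calc E' * presMatrix E E' φ = LinearMap.toMatrix' (Matrix.toLin' E') * presMatrix E E' φ := by rw [LinearMap.toMatrix'_toLin']
    _ = presMatrix E E' φ := by rw [presMatrix, ← LinearMap.toMatrix'_comp, h]

variable {E} in
/-- `P(φ) E = P(φ)` (idempotent `E`). [cite: Conrad2004GrossZagier, §7] -/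
theorem presMatrix_mul (hE : E * E = E) : presMatrix E E' φ * E = presMatrix E E' φ := by
  have h : ((LinearMap.range (Matrix.toLin' E')).subtype ∘ₗ φ ∘ₗ rangeProj E) ∘ₗ Matrix.toLin' E =
      (LinearMap.range (Matrix.toLin' E')).subtype ∘ₗ φ ∘ₗ rangeProj E := by
    rw [LinearMap.comp_assoc, LinearMap.comp_assoc, rangeProj_comp_toLin' hE]
  calc presMatrix E E' φ * E = presMatrix E E' φ * LinearMap.toMatrix' (Matrix.toLin' E) := by rw [LinearMap.toMatrix'_toLin']
    _ = presMatrix E E' φ := by rw [presMatrix, ← LinearMap.toMatrix'_comp, h]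

variable {E E'} in
/-- **`E′ P(φ) = P(φ) E`** — the one-sided intertwining consumed by ★ `SerreTensorModuleMap`. [cite: Conrad2004GrossZagier, §7] -/
theorem presMatrix_intertwines (hE : E * E = E) (hE' : E' * E' = E') : E' * presMatrix E E' φ = presMatrix E E' φ * E := by
  rw [mul_presMatrix E φ hE', presMatrix_mul E' φ hE]

/-- `P(id) = E`. [cite: Conrad2004GrossZagier, §7] -/
theorem presMatrix_id : presMatrix E E LinearMap.id = E := by
  rw [presMatrix, LinearMap.id_comp, subtype_comp_rangeProj, LinearMap.toMatrix'_toLin']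

variable {E'} in
/-- **Functoriality** `P(ψ ∘ φ) = P(ψ) P(φ)` (idempotent middle presentation `E′`). [cite: Conrad2004GrossZagier, §7] -/
theorem presMatrix_comp (hE' : E' * E' = E') (ψ : LinearMap.range (Matrix.toLin' E') →ₗ[R] LinearMap.range (Matrix.toLin' E'')) :
    presMatrix E E'' (ψ ∘ₗ φ) = presMatrix E' E'' ψ * presMatrix E E' φ := by
  have hps : ∀ y, rangeProj E' ((LinearMap.range (Matrix.toLin' E')).subtype y) = y := fun y => by
    rw [← LinearMap.comp_apply, rangeProj_comp_subtype hE', LinearMap.id_apply]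
  rw [presMatrix, presMatrix, presMatrix, ← LinearMap.toMatrix'_comp]
  congr 1
  refine LinearMap.ext fun v => ?_
  simp only [LinearMap.comp_apply, hps]

/-- Additivity `P(φ + ψ) = P(φ) + P(ψ)`. [cite: Conrad2004GrossZagier, §7] -/
theorem presMatrix_add (ψ : LinearMap.range (Matrix.toLin' E) →ₗ[R] LinearMap.range (Matrix.toLin' E')) :
    presMatrix E E' (φ + ψ) = presMatrix E E' φ + presMatrix E E' ψ := by
  rw [presMatrix, presMatrix, presMatrix, LinearMap.add_comp, LinearMap.comp_add, map_add]

/-- `P(0) = 0`. [cite: Conrad2004GrossZagier, §7] -/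
theorem presMatrix_zero : presMatrix E E' (0 : LinearMap.range (Matrix.toLin' E) →ₗ[R] LinearMap.range (Matrix.toLin' E')) = 0 := by
  rw [presMatrix, LinearMap.zero_comp, LinearMap.comp_zero, map_zero]

/-- `P(r • φ) = r • P(φ)`. [cite: Conrad2004GrossZagier, §7] -/
theorem presMatrix_smul (r : R) : presMatrix E E' (r • φ) = r • presMatrix E E' φ := by
  rw [presMatrix, presMatrix, LinearMap.smul_comp, LinearMap.comp_smul, map_smul]

variable {E} in
/-- **`P(φ)` recovers `φ`**: `P(φ)·x = φ(x)` for `x ∈ E·Rⁿ`. [cite: Conrad2004GrossZagier, §7] -/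
theorem toLin'_presMatrix_subtype (hE : E * E = E) (x : LinearMap.range (Matrix.toLin' E)) :
    Matrix.toLin' (presMatrix E E' φ) (x : Fin n → R) = (φ x : Fin m → R) := by
  have hx : rangeProj E (x : Fin n → R) = x := by
    have h := LinearMap.congr_fun (rangeProj_comp_subtype hE) x
    rw [LinearMap.comp_apply, LinearMap.id_apply] at h
    exact h
  rw [toLin'_presMatrix, LinearMap.comp_apply, LinearMap.comp_apply, hx, Submodule.subtype_apply]

variable {E E'} in
/-- An isomorphism `φ` gives the intertwining pair: `P(φ⁻¹) P(φ) = E`. [cite: Conrad2004GrossZagier, §7] -/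
theorem presMatrix_symm_mul (hE' : E' * E' = E')
    (φ : LinearMap.range (Matrix.toLin' E) ≃ₗ[R] LinearMap.range (Matrix.toLin' E')) :
    presMatrix E' E φ.symm.toLinearMap * presMatrix E E' φ.toLinearMap = E := by
  rw [← presMatrix_comp E E φ.toLinearMap hE' φ.symm.toLinearMap, LinearEquiv.symm_comp, presMatrix_id]

variable {E E'} in
/-- … and `P(φ) P(φ⁻¹) = E′`. [cite: Conrad2004GrossZagier, §7] -/
theorem presMatrix_mul_symm (hE : E * E = E)
    (φ : LinearMap.range (Matrix.toLin' E) ≃ₗ[R] LinearMap.range (Matrix.toLin' E')) :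
    presMatrix E E' φ.toLinearMap * presMatrix E' E φ.symm.toLinearMap = E' := by
  rw [← presMatrix_comp E' E' φ.symm.toLinearMap hE φ.toLinearMap, LinearEquiv.comp_symm, presMatrix_id]

end PresMatrix

end Literature.Algebra.Module.IdempotentMatrix
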